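import Summits.QuantumFields.YangMills.Theorems.UnitScaleTiltFluctuationComparisonRegPrGlobalSlackKernelLegWeights
import Summits.QuantumFields.YangMills.Theorems.UnitScaleTiltFluctuationComparisonRegPrGlobalSlackCanonicalEndToEndC
import HarnessLib

/-!
# `UnitScaleTiltFluctuationComparisonRegPrGlobalSlackKernelLegEndToEnd` — (45)'S MECHANISM AS A THEOREM AND STUB 3⁗ FROM THE LEG-CURRENCY ROWS, BY NAME
# (crux `FluctuationComparisonRegPrIntL`, stmt-QuantumFields-20520 — formerly 19935 —, STUB 3⁗ `stub_globalTwoRunSlackFam`; width-lever lane A; OWNER ym3-torus-plan g23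
# RULING №1 §B W-slack-2)

Seat ym-ust-19935-slack g2 (prover).  Companion of `…GlobalSlackKernelLegWeights` (the bond-diagonal rescaling and the transfer of the leg rows to the sup-norm rows of
record).  Here:

* §1 **PRINT'S (45) MECHANISM, PROVED** (generic multilinear algebra): if the coefficient of every monomial `x₁(c₁) ⊗ ⋯ ⊗ x_d(c_d)` of a `d`-linear form on a finite
  product is bounded leg by leg, `‖M(δ_{c₁}v₁, …, δ_{c_d}v_d)‖ ≤ A·Π_i a(c_i)·Π_i‖v_i‖`, then the form precomposed with the diagonal weights `w` has operator norm
  `≤ A·(Σ_c ‖w(c)‖·a(c))^d` (`opNorm_compDiag_le_of_legs`: expand each slot along `Pi.single`, `ContinuousMultilinearMap.map_sum`, `Finset.prod_univ_sum`) —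
  «summation over all Y_j with y fixed yields …» (45) p.267;
* §2 the POINTWISE leg row `KernelLegPointwiseΦ` (print's (43) shape verbatim: `O(1)·e^{−κ𝓛}·Π_i e^{−κ₁ d(c_i)}`, `g`-free) and the geometric summability row
  `LegSummable` (`Σ_c e^{−κ₂ d(c)} ≤ S`, a property of the lattice and the polymer parameter); **`kernelLegΦ_of_pointwise`**: for `κ′ + κ₂ ≤ κ₁` they give the weighted
  kernel size `KernelLegΦ … κ′ κ (A·S⁶)`;
* §3 **`K1aLegRowsK L 𝔠 a₀ a₁ a`** — the K1a line in LEG CURRENCY at the canonical polymerisation: for every family / coupling / inhabited v3 package a coherent `p`, a leg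
  distance `dist` (nonnegative, matched across the runs), a weight rate `κ′ > 0`, and ONE chart family with `TaylorSplitΦ (canonPT p)`, K1a `FlatKernelLegCauchyΦ`,
  `KernelLegΦ`, `RemainderSmallΦ`, `CfgDistΦ`, `CfgDistCauchyΦ` at the record's decay `𝔠.κ` and the window profile `p₀` — NO letter on the record, NO polylogarithm,
  NO coupling factor; **`k1aChartRowsK_of_legRowsK : K1aLegRowsK → K1aChartRowsK`** (rescaled pair `(Φ∘D_w, D_w⁻¹B)`, constants `×(1 + κ′⁻¹)`);
  **`globalTwoRunSlackFam_of_k1aLegRowsK : (∀ L …, ∃ a, 0 < a ∧ a < 1 ∧ K1aLegRowsK L 𝔠 a₀ a₁ a) → ⟨THE REGISTERED TEXT OF stub_globalTwoRunSlackFam⟩`**;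
  and the pointwise form **`K1aLegRowsP`** ((43) pointwise + `LegSummable`) with **`globalTwoRunSlackFam_of_k1aLegRowsP`**.
So 3⁗ is, BY NAME, the K1a line in the currency print displays for the MERGED family ((43) `O(1)` per-leg-decaying coefficients, (44) distance-form loop variables):
what the (α) record has to display is exactly these objects (ideator 2 N8 R0; lit L-36 (A)), and the located non-reach of the sup-norm currency for the `g`-free
Λ-terms (W-slack-2) is gone.  Every `def … : Prop` is a hypothesis schema (never asserted); nothing of [Balaban1985UV3]/[King1986] is asserted.

References: T. Bałaban, CMP 102 (1985) 255–275 [Balaban1985UV3] ((27)–(28) p.263, (33)–(34) p.264, (43)–(46) pp.266–267, (57) p.270); C. King, CMP 102 (1986)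
649–677 [King1986] (Thm 3.4 (3.9) p.656, Prop. 3.6 (3.55)–(3.56) p.662, Prop. 3.9 (3.71)–(3.74) p.665).
-/

set_option autoImplicit false

noncomputable section

open scoped BigOperators
open Literature.MathematicalPhysics.QuantumFieldTheory.Balaban1983to89
open Literature.MathematicalPhysics.QuantumFieldTheory.Balaban1983to89.T3ContinuumYM3Torus
open Literature.MathematicalPhysics.QuantumFieldTheory.Balaban1983to89.T3UnitScaleTilt
open Literature.MathematicalPhysics.QuantumFieldTheory.Balaban1983to89.T3LevelShift
open Literature.MathematicalPhysics.QuantumFieldTheory.Balaban1983to89.T3AlphaInputsAC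
open Literature.MathematicalPhysics.QuantumFieldTheory.Balaban1983to89.T3AlphaPolymerSocket
open Literature.MathematicalPhysics.QuantumFieldTheory.Balaban1983to89.T3AlphaInputsACTwoRun
open Literature.MathematicalPhysics.QuantumFieldTheory.Balaban1983to89.T3AlphaInputsACTwoRunLevel
open Summit.QuantumFields.Balaban3D.Carriers
open Summit.QuantumFields.Balaban3D.Proofs.Primitives
open Summit.QuantumFields.Balaban3D.Proofs.GroupModelLieC (lieC)
open Summit.QuantumFields.YangMills.Theorems
open Summit.QuantumFields.YangMills.Theorems.GlobalSlackKernelMatching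
open Summit.QuantumFields.YangMills.Theorems.GlobalSlackCanonicalPolymers
open Summit.QuantumFields.YangMills.Theorems.GlobalSlackKernelLeg

namespace Summit.QuantumFields.YangMills.Theorems.GlobalSlackKernelLeg

/-! ## §1 (45)'s mechanism: leg-wise coefficient bounds give the weighted operator norm -/

section Legs

variable {ι : Type*} [Fintype ι] [DecidableEq ι] {E G : Type*} [NormedAddCommGroup E] [NormedSpace ℂ E] [NormedAddCommGroup G] [NormedSpace ℂ G]

/-- **LEG-WISE COEFFICIENT BOUNDS GIVE THE WEIGHTED OPERATOR NORM** (print's (45) p.267 «summation over all Y_j with y fixed»): if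
`‖M(δ_{c₁}v₁, …, δ_{c_d}v_d)‖ ≤ A·Π_i a(c_i)·Π_i ‖v_i‖` for all leg positions `c` and values `v`, then `‖M ∘ D_w^{⊗d}‖ ≤ A·(Σ_c ‖w(c)‖·a(c))^d`.
[cite: Balaban1985UV3, (45) p.267] -/
theorem opNorm_compDiag_le_of_legs {d : ℕ} (M : ContinuousMultilinearMap ℂ (fun _ : Fin d => ι → E) G) (w : ι → ℂ) (hw : ∀ c, w c ≠ 0)
    {A : ℝ} (hA : 0 ≤ A) (a : ι → ℝ) (ha : ∀ c, 0 ≤ a c)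
    (hM : ∀ (c : Fin d → ι) (v : Fin d → E), ‖M (fun i => Pi.single (c i) (v i))‖ ≤ A * (∏ i, a (c i)) * ∏ i, ‖v i‖) :
    ‖M.compContinuousLinearMap (fun _ => ((diagEquiv (E := E) w hw : (ι → E) ≃L[ℂ] (ι → E)) : (ι → E) →L[ℂ] (ι → E)))‖ ≤
      A * (∑ c, ‖w c‖ * a c) ^ d := by
  have hS : 0 ≤ ∑ c, ‖w c‖ * a c := Finset.sum_nonneg fun c _ => mul_nonneg (norm_nonneg _) (ha c)
  refine ContinuousMultilinearMap.opNorm_le_bound (by positivity) fun x => ?_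
  rw [ContinuousMultilinearMap.compContinuousLinearMap_apply]
  have hexp : (fun i => ((diagEquiv (E := E) w hw : (ι → E) ≃L[ℂ] (ι → E)) : (ι → E) →L[ℂ] (ι → E)) (x i)) =
      fun i => ∑ c, Pi.single c (w c • x i c) := by
    funext i
    exact (Finset.univ_sum_single _).symm
  rw [hexp, ContinuousMultilinearMap.map_sum M (fun i c => Pi.single c (w c • x i c))]
  calc ‖∑ r : Fin d → ι, M (fun i => Pi.single (r i) (w (r i) • x i (r i)))‖
      ≤ ∑ r : Fin d → ι, ‖M (fun i => Pi.single (r i) (w (r i) • x i (r i)))‖ := norm_sum_le _ _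
    _ ≤ ∑ r : Fin d → ι, A * (∏ i, a (r i)) * ∏ i, ‖w (r i) • x i (r i)‖ := Finset.sum_le_sum fun r _ => hM r _
    _ ≤ ∑ r : Fin d → ι, A * ∏ i, (‖w (r i)‖ * a (r i) * ‖x i‖) := by
        refine Finset.sum_le_sum fun r _ => ?_
        rw [mul_assoc, ← Finset.prod_mul_distrib]
        refine mul_le_mul_of_nonneg_left (Finset.prod_le_prod (fun i _ => mul_nonneg (ha _) (norm_nonneg _)) fun i _ => ?_) hA
        rw [norm_smul]
        calc a (r i) * (‖w (r i)‖ * ‖x i (r i)‖) ≤ a (r i) * (‖w (r i)‖ * ‖x i‖) :=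
              mul_le_mul_of_nonneg_left (mul_le_mul_of_nonneg_left (norm_le_pi_norm (x i) (r i)) (norm_nonneg _)) (ha _)
          _ = _ := by ring
    _ = A * ∑ r : Fin d → ι, ∏ i, (‖w (r i)‖ * a (r i) * ‖x i‖) := by rw [Finset.mul_sum]
    _ = A * ∏ i : Fin d, ∑ c, (‖w c‖ * a c * ‖x i‖) := by
        rw [Finset.prod_univ_sum, Fintype.piFinset_univ]
    _ = A * ∏ i : Fin d, ((∑ c, ‖w c‖ * a c) * ‖x i‖) := by
        congr 1
        exact Finset.prod_congr rfl fun i _ => by rw [Finset.sum_mul]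
    _ = A * (∑ c, ‖w c‖ * a c) ^ d * ∏ i, ‖x i‖ := by
        rw [Finset.prod_mul_distrib, Finset.prod_const, Finset.card_univ, Fintype.card_fin]
        ring

end Legs

/-! ## §2 The pointwise leg row ((43) verbatim shape) and the geometric summability row -/

section Pointwise

variable {𝕍 : Type} [NormedAddCommGroup 𝕍] [NormedSpace ℂ 𝕍] {F : T3Family} {γ : ℝ}

/-- **POINTWISE LEG ROW — PRINT'S (43) FOR THE MERGED FAMILY** (hypothesis schema, never asserted): the coefficient of the monomial `v₁(c₁) ⊗ ⋯ ⊗ v_d(c_d)` of the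
order-`d` flat kernel is `≤ A·e^{−κ𝓛(Y)}·Π_i e^{−κ₁ d(c_i)}·Π‖v_i‖` — «|𝒫_j(Y_j)| ≤ O(1)·Π_i exp(−κ₁(M₁Lʲη)⁻¹|c_{i,−} − y|)», `O(1)` and `g`-FREE (p.265 L13–16: the
normalisation-factor kernels carry no coupling). [cite: Balaban1985UV3, (43) p.266, p.265 L13-16] -/
def KernelLegPointwiseΦ (D : AlphaDataT3 F γ) (Φ : ChartFam 𝕍 F) (dist : LegDist F) (κ₁ κ A : ℝ) : Prop :=
  ∀ (K k b : ℕ) (Y : Set (Site (F.P K) 0)), Y ∈ D.Loc K k (D.triv K k) (1 + b) →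
    ∀ d ∈ Finset.Ico 2 7, ∀ (c : Fin d → PBond (F.P K) b) (v : Fin d → 𝕍),
      ‖ker Φ K b Y d (fun i => Pi.single (c i) (v i))‖ ≤
        A * Real.exp (-κ * D.treeLen K (1 + b) Y) * (∏ i, Real.exp (-(κ₁ * dist K b Y (c i)))) * ∏ i, ‖v i‖

omit [NormedAddCommGroup 𝕍] [NormedSpace ℂ 𝕍] in
/-- **GEOMETRIC SUMMABILITY OF THE LEG DECAY** (hypothesis schema, never asserted; lattice geometry of `π`): `Σ_c e^{−κ₂ d(c)} ≤ S` uniformly in run, level and domain —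
the bonds at distance `∼ r` from the anchor number `O(r²)` ((45) p.267). [cite: Balaban1985UV3, (45) p.267] -/
def LegSummable (dist : LegDist F) (κ₂ S : ℝ) : Prop :=
  ∀ (K b : ℕ) (Y : Set (Site (F.P K) 0)), ∑ c : PBond (F.P K) b, Real.exp (-(κ₂ * dist K b Y c)) ≤ S

/-- **THE WEIGHTED KERNEL SIZE FROM THE POINTWISE (43) ROW**: for weights `κ′` with `κ′ + κ₂ ≤ κ₁`, nonnegative distances and `1 ≤ S`,
`KernelLegPointwiseΦ … κ₁ κ A ∧ LegSummable … κ₂ S ⟹ KernelLegΦ … κ′ κ (A·S⁶)` — (45)'s mechanism (§1) with `a(c) = e^{−κ₁d(c)}`, `‖w(c)‖·a(c) ≤ e^{−κ₂d(c)}`.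
[cite: Balaban1985UV3, (43) p.266, (45) p.267] -/
theorem kernelLegΦ_of_pointwise {D : AlphaDataT3 F γ} {Φ : ChartFam 𝕍 F} {dist : LegDist F} {κ₁ κ₂ κ' κ A S : ℝ}
    (hn : DistNonneg dist) (hκ : κ' + κ₂ ≤ κ₁) (hA : 0 ≤ A) (hS : 1 ≤ S)
    (hP : KernelLegPointwiseΦ D Φ dist κ₁ κ A) (hsum : LegSummable dist κ₂ S) : KernelLegΦ D Φ dist κ' κ (A * S ^ 6) := by
  classical
  intro K k b Y hY d hd
  have hd6 : d ≤ 6 := by have := (Finset.mem_Ico.mp hd).2; omega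
  have hAe : 0 ≤ A * Real.exp (-κ * D.treeLen K (1 + b) Y) := mul_nonneg hA (Real.exp_pos _).le
  have hleg := opNorm_compDiag_le_of_legs (ker Φ K b Y d) (legW dist κ' K b Y) (legW_ne_zero dist κ' K b Y) hAe
    (fun c => Real.exp (-(κ₁ * dist K b Y c))) (fun c => (Real.exp_pos _).le) (fun c v => hP K k b Y hY d hd c v)
  refine hleg.trans ?_
  -- the weighted leg sum: `Σ_c e^{κ′d}·e^{−κ₁d} ≤ Σ_c e^{−κ₂d} ≤ S`
  have hsumle : ∑ c : PBond (F.P K) b, ‖legW dist κ' K b Y c‖ * Real.exp (-(κ₁ * dist K b Y c)) ≤ S := by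
    refine (Finset.sum_le_sum fun c _ => ?_).trans (hsum K b Y)
    rw [norm_legW, ← Real.exp_add, Real.exp_le_exp]
    have := hn K b Y c
    nlinarith
  have hsum0 : 0 ≤ ∑ c : PBond (F.P K) b, ‖legW dist κ' K b Y c‖ * Real.exp (-(κ₁ * dist K b Y c)) :=
    Finset.sum_nonneg fun c _ => mul_nonneg (norm_nonneg _) (Real.exp_pos _).le
  have hS0 : 0 ≤ S := zero_le_one.trans hS
  calc A * Real.exp (-κ * D.treeLen K (1 + b) Y) * (∑ c, ‖legW dist κ' K b Y c‖ * Real.exp (-(κ₁ * dist K b Y c))) ^ d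
      ≤ A * Real.exp (-κ * D.treeLen K (1 + b) Y) * S ^ d := mul_le_mul_of_nonneg_left (pow_le_pow_left₀ hsum0 hsumle d) hAe
    _ ≤ A * Real.exp (-κ * D.treeLen K (1 + b) Y) * S ^ 6 := mul_le_mul_of_nonneg_left (pow_le_pow_right₀ hS hd6) hAe
    _ = A * S ^ 6 * Real.exp (-κ * D.treeLen K (1 + b) Y) := by ring

end Pointwise

/-! ## §3 The K1a line in leg currency at the canonical polymerisation, and the registered stub -/

/-- **THE K1a LEG ROWS AT THE CANONICAL POLYMERISATION** (hypothesis schema, never asserted): a weight rate `κ′ > 0`, nonnegative constants, a threshold, and for every family /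
coupling / inhabited v3 package a coherent family `p` with the given [7]-constants, a LEG DISTANCE `dist` (nonnegative, matched across the two runs) and ONE chart family
with configurations / vacuum constants / rests carrying `TaylorSplitΦ (canonPT p)`, K1a in leg currency `FlatKernelLegCauchyΦ`, the weighted kernel size `KernelLegΦ`,
`RemainderSmallΦ`, and the DISTANCE-FORM configuration rows `CfgDistΦ` / `CfgDistCauchyΦ` ((44)) — at the record's decay `𝔠.κ` and the WINDOW profile `p₀`: no letter
on the record, no collar polylogarithm, no coupling factor in the kernels. [cite: Balaban1985UV3, (43)-(46) pp.266-267, (57) p.270; King1986, Prop. 3.6 (3.56) p.662, Prop. 3.9 (3.71)-(3.74) p.665] -/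
def K1aLegRowsK (L : ℕ) (𝔠 : AlphaConsts L (suGroupModel 2).N) (a₀ a₁ a : ℝ) : Prop :=
  ∃ (κ' C C_E C_R C_s C_B γB : ℝ), 0 < κ' ∧ 0 ≤ C ∧ 0 ≤ C_E ∧ 0 ≤ C_R ∧ 0 ≤ C_s ∧ 0 ≤ C_B ∧ 0 < γB ∧
    ∀ (F : T3Family) (γ : ℝ) (hF : F.L = L) (hγ : 0 < γ), γ ≤ γB → ∀ (hγ1 : γ ≤ (min (hF ▸ 𝔠).gamma0 1) ^ 2),
      AlphaInputsT3AC.OfV3At F (hF ▸ 𝔠) a₀ a₁ →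
        ∃ (p : ∀ K, AlphaInputsT3AC.PkgAtV3 F (hF ▸ 𝔠) γ hγ hγ1 K), (∀ K, (p K).a₀ = a₀ ∧ (p K).a₁ = a₁) ∧
          ∃ (dist : LegDist F) (Φ : ChartFam ↥(lieC (suGroupModel 2)) F) (e : VacFam F) (B : CfgFam ↥(lieC (suGroupModel 2)) F) (R : RemFam F),
            DistNonneg dist ∧ DistMatched dist ∧
            TaylorSplitΦ (canonPT p) Φ e B R ∧
            FlatKernelLegCauchyΦ (AlphaInputsT3AC.dataOfV3 p (canonPolymer p)) Φ dist κ' (hF ▸ 𝔠).κ a C ∧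
            KernelLegΦ (AlphaInputsT3AC.dataOfV3 p (canonPolymer p)) Φ dist κ' (hF ▸ 𝔠).κ C_E ∧
            RemainderSmallΦ (AlphaInputsT3AC.dataOfV3 p (canonPolymer p)) R (hF ▸ 𝔠).b₀ (hF ▸ 𝔠).p₀ (hF ▸ 𝔠).κ C_R ∧
            CfgDistΦ (AlphaInputsT3AC.dataOfV3 p (canonPolymer p)) B dist (hF ▸ 𝔠).b₀ (hF ▸ 𝔠).p₀ C_s ∧
            CfgDistCauchyΦ (AlphaInputsT3AC.dataOfV3 p (canonPolymer p)) B dist (hF ▸ 𝔠).b₀ (hF ▸ 𝔠).p₀ a C_B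

/-- **THE LEG ROWS GIVE THE CHART ROWS OF RECORD** for the rescaled pair `(Φ ∘ D_w, D_w⁻¹B)` — same decay `𝔠.κ`, same profile `p₀`, same rate `a`, configuration
constants `× (1 + κ′⁻¹)` (`…KernelLegWeights` §4). [cite: Balaban1985UV3, (43)-(45) pp.266-267; King1986, Prop. 3.6 (3.56) p.662] -/
theorem k1aChartRowsK_of_legRowsK {L : ℕ} {𝔠 : AlphaConsts L (suGroupModel 2).N} {a₀ a₁ a : ℝ} (h : K1aLegRowsK L 𝔠 a₀ a₁ a) :
    K1aChartRowsK L 𝔠 a₀ a₁ a := by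
  obtain ⟨κ', C, C_E, C_R, C_s, C_B, γB, hκ', hC, hCE, hCR, hCs, hCB, hγB, hall⟩ := h
  have hk1 : 0 ≤ 1 + κ'⁻¹ := by positivity
  refine ⟨C, C_E, C_R, C_s * (1 + κ'⁻¹), C_B * (1 + κ'⁻¹), γB, hC, hCE, hCR, mul_nonneg hCs hk1, mul_nonneg hCB hk1, hγB,
    fun F γ hF hγ hγle hγ1 hOf => ?_⟩
  subst hF
  obtain ⟨p, hp, dist, Φ, e, B, R, hn, hm, hT, hK, hE, hR, hS, hBC⟩ := hall F γ rfl hγ hγle hγ1 hOf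
  have hL : 1 ≤ F.L := F.hL.2.le
  have hγ1' : γ ≤ 1 := hγ1.trans (sq_min_one_le _ 𝔠.gamma0_pos)
  exact ⟨p, hp, rescaleΦw dist κ' Φ, e, rescaleBw dist κ' B, R, taylorSplitΦ_rescaleW dist κ' hT, flatKernelCauchyΦ_rescaleW hm hK,
    kernelSizeΦ_rescaleW hE, hR, cfgSizeΦ_rescaleW hL hγ hγ1' 𝔠.b₀_pos hn hm hκ' hCs hS, cfgCauchyΦ_rescaleW hL hγ hγ1' 𝔠.b₀_pos hn hm hκ' hCB hBC⟩

/-- **THE REGISTERED STUB 3⁗ FROM THE K1a LINE IN LEG CURRENCY, BY NAME** (`globalTwoRunSlackFam_of_k1aChartRowsK ∘ k1aChartRowsK_of_legRowsK`): if for every odd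
`L ≥ 7`, every constants record and [7]-constants there is a rate exponent `0 < a < 1` with `K1aLegRowsK L 𝔠 a₀ a₁ a`, then the text of `stub_globalTwoRunSlackFam`
(skeleton v5k `Cruxes/FluctuationComparisonRegPrIntL/Lines/birth_v5k.lean`) holds VERBATIM. [cite: King1986, Thm 3.4 (3.9) p.656, Prop. 3.6 p.662; Balaban1985UV3, (43)-(46) pp.266-267, (57) p.270] -/
theorem globalTwoRunSlackFam_of_k1aLegRowsK
    (h : ∀ (L : ℕ), Odd L → 7 ≤ L → ∀ (𝔠 : AlphaConsts L (suGroupModel 2).N) (a₀ a₁ : ℝ), 0 < a₀ → 0 < a₁ → 𝔠.B₃ * a₁ ≤ a₀ →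
      ∃ a : ℝ, 0 < a ∧ a < 1 ∧ K1aLegRowsK L 𝔠 a₀ a₁ a) :
    ∀ (L : ℕ), Odd L → 7 ≤ L → ∀ (𝔠 : Summit.QuantumFields.Balaban3D.Proofs.Primitives.AlphaConsts L (Summit.QuantumFields.Balaban3D.Carriers.suGroupModel 2).N)
      (a₀ a₁ : ℝ), 0 < a₀ → 0 < a₁ → 𝔠.B₃ * a₁ ≤ a₀ →
      ∃ a : ℝ, 0 < a ∧ ∃ γB : ℝ, 0 < γB ∧ ∀ (F : T3Family) (γ : ℝ) (hF : F.L = L) (hγ : 0 < γ), γ ≤ γB →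
        ∀ (hγ1 : γ ≤ (min (hF ▸ 𝔠).gamma0 1) ^ 2),
          Summit.QuantumFields.YangMills.Theorems.AlphaInputsT3AC.OfV3At F (hF ▸ 𝔠) a₀ a₁ →
          ∃ (p : ∀ K, Summit.QuantumFields.YangMills.Theorems.AlphaInputsT3AC.PkgAtV3 F (hF ▸ 𝔠) γ hγ hγ1 K),
            (∀ K, (p K).a₀ = a₀ ∧ (p K).a₁ = a₁) ∧
            ∃ (π : Summit.QuantumFields.YangMills.Theorems.AlphaInputsT3AC.PolymerT3 F) (σ : ℕ) (C : ℝ), 7 ≤ σ ∧ 0 ≤ C ∧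
              Summit.QuantumFields.YangMills.Theorems.GlobalSlack.GlobalSupRateTSlack (Summit.QuantumFields.YangMills.Theorems.AlphaInputsT3AC.dataOfV3 p π) (hF ▸ 𝔠).b₀ (hF ▸ 𝔠).p₀ a σ C :=
  globalTwoRunSlackFam_of_k1aChartRowsK fun L hLo h7 𝔠 a₀ a₁ ha0 ha1 hw => by
    obtain ⟨a, ha, ha1', hc⟩ := h L hLo h7 𝔠 a₀ a₁ ha0 ha1 hw
    exact ⟨a, ha, ha1', k1aChartRowsK_of_legRowsK hc⟩

/-- **THE K1a LEG ROWS, POINTWISE FORM** (hypothesis schema, never asserted): `K1aLegRowsK` with the weighted kernel size REPLACED by print's pointwise (43) row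
`KernelLegPointwiseΦ … κ₁ 𝔠.κ A` (per-leg decay rate `κ₁ > κ′`) and the geometric summability `LegSummable dist (κ₁ − κ′) S` — the form in which the (α) record would
display the merged family's kernels. [cite: Balaban1985UV3, (43)-(46) pp.266-267; King1986, Prop. 3.6 (3.56) p.662] -/
def K1aLegRowsP (L : ℕ) (𝔠 : AlphaConsts L (suGroupModel 2).N) (a₀ a₁ a : ℝ) : Prop :=
  ∃ (κ' κ₁ S C A C_R C_s C_B γB : ℝ), 0 < κ' ∧ κ' < κ₁ ∧ 1 ≤ S ∧ 0 ≤ C ∧ 0 ≤ A ∧ 0 ≤ C_R ∧ 0 ≤ C_s ∧ 0 ≤ C_B ∧ 0 < γB ∧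
    ∀ (F : T3Family) (γ : ℝ) (hF : F.L = L) (hγ : 0 < γ), γ ≤ γB → ∀ (hγ1 : γ ≤ (min (hF ▸ 𝔠).gamma0 1) ^ 2),
      AlphaInputsT3AC.OfV3At F (hF ▸ 𝔠) a₀ a₁ →
        ∃ (p : ∀ K, AlphaInputsT3AC.PkgAtV3 F (hF ▸ 𝔠) γ hγ hγ1 K), (∀ K, (p K).a₀ = a₀ ∧ (p K).a₁ = a₁) ∧
          ∃ (dist : LegDist F) (Φ : ChartFam ↥(lieC (suGroupModel 2)) F) (e : VacFam F) (B : CfgFam ↥(lieC (suGroupModel 2)) F) (R : RemFam F),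
            DistNonneg dist ∧ DistMatched dist ∧ LegSummable dist (κ₁ - κ') S ∧
            TaylorSplitΦ (canonPT p) Φ e B R ∧
            FlatKernelLegCauchyΦ (AlphaInputsT3AC.dataOfV3 p (canonPolymer p)) Φ dist κ' (hF ▸ 𝔠).κ a C ∧
            KernelLegPointwiseΦ (AlphaInputsT3AC.dataOfV3 p (canonPolymer p)) Φ dist κ₁ (hF ▸ 𝔠).κ A ∧
            RemainderSmallΦ (AlphaInputsT3AC.dataOfV3 p (canonPolymer p)) R (hF ▸ 𝔠).b₀ (hF ▸ 𝔠).p₀ (hF ▸ 𝔠).κ C_R ∧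
            CfgDistΦ (AlphaInputsT3AC.dataOfV3 p (canonPolymer p)) B dist (hF ▸ 𝔠).b₀ (hF ▸ 𝔠).p₀ C_s ∧
            CfgDistCauchyΦ (AlphaInputsT3AC.dataOfV3 p (canonPolymer p)) B dist (hF ▸ 𝔠).b₀ (hF ▸ 𝔠).p₀ a C_B

/-- The pointwise form gives the weighted form (`kernelLegΦ_of_pointwise`, `C_E := A·S⁶`). [cite: Balaban1985UV3, (43) p.266, (45) p.267] -/
theorem k1aLegRowsK_of_P {L : ℕ} {𝔠 : AlphaConsts L (suGroupModel 2).N} {a₀ a₁ a : ℝ} (h : K1aLegRowsP L 𝔠 a₀ a₁ a) : K1aLegRowsK L 𝔠 a₀ a₁ a := by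
  obtain ⟨κ', κ₁, S, C, A, C_R, C_s, C_B, γB, hκ', hκ1, hS, hC, hA, hCR, hCs, hCB, hγB, hall⟩ := h
  refine ⟨κ', C, A * S ^ 6, C_R, C_s, C_B, γB, hκ', hC, mul_nonneg hA (pow_nonneg (zero_le_one.trans hS) 6), hCR, hCs, hCB, hγB,
    fun F γ hF hγ hγle hγ1 hOf => ?_⟩
  obtain ⟨p, hp, dist, Φ, e, B, R, hn, hm, hsum, hT, hK, hP, hR, hSz, hBC⟩ := hall F γ hF hγ hγle hγ1 hOf
  exact ⟨p, hp, dist, Φ, e, B, R, hn, hm, hT, hK, kernelLegΦ_of_pointwise hn (by linarith) hA hS hP hsum, hR, hSz, hBC⟩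

/-- **THE REGISTERED STUB 3⁗ FROM THE POINTWISE LEG ROWS, BY NAME** (`globalTwoRunSlackFam_of_k1aLegRowsK ∘ k1aLegRowsK_of_P`).
[cite: King1986, Thm 3.4 (3.9) p.656, Prop. 3.6 p.662; Balaban1985UV3, (43)-(46) pp.266-267, (57) p.270] -/
theorem globalTwoRunSlackFam_of_k1aLegRowsP
    (h : ∀ (L : ℕ), Odd L → 7 ≤ L → ∀ (𝔠 : AlphaConsts L (suGroupModel 2).N) (a₀ a₁ : ℝ), 0 < a₀ → 0 < a₁ → 𝔠.B₃ * a₁ ≤ a₀ →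
      ∃ a : ℝ, 0 < a ∧ a < 1 ∧ K1aLegRowsP L 𝔠 a₀ a₁ a) :
    ∀ (L : ℕ), Odd L → 7 ≤ L → ∀ (𝔠 : Summit.QuantumFields.Balaban3D.Proofs.Primitives.AlphaConsts L (Summit.QuantumFields.Balaban3D.Carriers.suGroupModel 2).N)
      (a₀ a₁ : ℝ), 0 < a₀ → 0 < a₁ → 𝔠.B₃ * a₁ ≤ a₀ →
      ∃ a : ℝ, 0 < a ∧ ∃ γB : ℝ, 0 < γB ∧ ∀ (F : T3Family) (γ : ℝ) (hF : F.L = L) (hγ : 0 < γ), γ ≤ γB →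
        ∀ (hγ1 : γ ≤ (min (hF ▸ 𝔠).gamma0 1) ^ 2),
          Summit.QuantumFields.YangMills.Theorems.AlphaInputsT3AC.OfV3At F (hF ▸ 𝔠) a₀ a₁ →
          ∃ (p : ∀ K, Summit.QuantumFields.YangMills.Theorems.AlphaInputsT3AC.PkgAtV3 F (hF ▸ 𝔠) γ hγ hγ1 K),
            (∀ K, (p K).a₀ = a₀ ∧ (p K).a₁ = a₁) ∧
            ∃ (π : Summit.QuantumFields.YangMills.Theorems.AlphaInputsT3AC.PolymerT3 F) (σ : ℕ) (C : ℝ), 7 ≤ σ ∧ 0 ≤ C ∧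
              Summit.QuantumFields.YangMills.Theorems.GlobalSlack.GlobalSupRateTSlack (Summit.QuantumFields.YangMills.Theorems.AlphaInputsT3AC.dataOfV3 p π) (hF ▸ 𝔠).b₀ (hF ▸ 𝔠).p₀ a σ C :=
  globalTwoRunSlackFam_of_k1aLegRowsK fun L hLo h7 𝔠 a₀ a₁ ha0 ha1 hw => by
    obtain ⟨a, ha, ha1', hc⟩ := h L hLo h7 𝔠 a₀ a₁ ha0 ha1 hw
    exact ⟨a, ha, ha1', k1aLegRowsK_of_P hc⟩

end Summit.QuantumFields.YangMills.Theorems.GlobalSlackKernelLeg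

end
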